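import Mathlib
import HarnessLib
import Summits.NavierStokesRegularity.NavierStokesRegularity.Theses.TrappingWindowRungThree
import Summits.NavierStokesRegularity.NavierStokesRegularity.Theorems.TrappingWindowRungThreeShadowingTransferWindow

/-!
# `TrappingWindowRungThree.ShadowingTransfer` (item stmt-NavierStokesRegularity-22924)

The exact-flow certificate (K1a, the body of `ExactFlowCertificate`, item stmt-22916) implies the
inclusion trapping certificate `WindowCertificate` (K1) with the SAME table, window, frames, boxes,
sup bounds and tail parameters.

PROOF.  The static clauses are copied (the datum sits in the `s`-shrunk box `B_0`, every box sits
`Λδτs·ω + mm` inside the sup bounds by clause EPOCH at time `0`).  For the trapping dichotomy, take a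
`C¹` window trajectory `S` of the `(η, η)`-defect inclusion started in `B_j` with boundary shells
under the tail envelopes on `[0, σ]`, and the certified exact orbit `x` from the same window state
(clause EPOCH: step time `τq ≤ τs ≤ c`, arrival level `|x_{i₀,1}(τq)| ≥ as j`, landing of the
shifted rescaled state in the `s`-shrunk box `B_{nx j}` for every admissible new top shell, margin
`M - Λδτs·ω - mm`, two-point flow-Lipschitz clause TUBE on the `κ j`-tube).  By clause DIST the
window part of `S` is, while `|S_k| ≤ M_k`, a pseudo-orbit of the window-truncated field with
shellwise defect `≤ δ j · ω j k`; the weighted shadowing theorem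
`ShadowingTransfer.window_shadowing` (Lady Windermere fan in Dini form + first-exit bootstrap, files
`…ShadowingTransferFlow/Core/Window`) gives `|S_{i,k}(t) - x_{i,k}(t)| ≤ Λ j δ j τs · ω j k` on
`[0, min σ τq]`, whence `|S_k| ≤ M_k - mm` there.  If `σ < τq` this is the STRICTLY-INSIDE branch
(`σ < τq ≤ τs ≤ c`).  If `τq ≤ σ` the STEP branch holds at `τ₁ = τq` with ratio
`a = |S_{i₀,1}(τq)| / Lv (nx j)`: the ratio floor `2^{-θ} ≤ a ≤ |S_{i₀,1}(τq)|` comes from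
`2^{-θ} Lv ≤ as - Λδτs·ω 1` and `Lv ≥ 1`, the landing in `B_{nx j}` from the certificate's landing
of the `x`-state plus the operator-norm margin clause applied to the deviation (elementary estimates
`dev_bound_inner` / `dev_bound_top`), the bottom-shell exit from clause EPOCH's bottom margin, and
the window bounds from the shadowing margin.

HONEST FRAMING: a statement about Tao-type MODEL lattice ODEs (rung TL-M3 of the NS ladder); the
certificate K1a itself is NOT proved here (it is the hypothesis), nothing here is a statement about
the Navier–Stokes equations, and NS regularity is NOT proved by anything in this file.
-/

noncomputable section

-- the sub-problem namespace repeats the summit name by design (D-0017)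
set_option linter.dupNamespace false

namespace Summit.NavierStokesRegularity.NavierStokesRegularity.Theorems

open Set Filter Topology Literature.Analysis.FluidPDE Literature.Analysis.FluidPDE.TaoCascade

namespace ShadowingTransfer

/-- Deviation of the shifted rescaled window state from the certified landing state, inner shells:
`|Lv S'/aS - Lv x'/ax| ≤ (Dk + Mk·D1/as)·2^θ` when `|S' - x'| ≤ Dk`, `|x'| ≤ Mk`, `|ax - aS| ≤ D1`,
`as ≤ ax` and `Lv ≤ 2^θ aS`. [folklore] -/
theorem dev_bound_inner {Lv aS ax asj th Dk D1 Mk S' x' : ℝ} (haS : 0 < aS) (hax : 0 < ax)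
    (hasj : 0 < asj) (hasx : asj ≤ ax) (hLv0 : 0 ≤ Lv) (hLv : Lv ≤ th * aS)
    (hS : |S' - x'| ≤ Dk) (hx : |x'| ≤ Mk) (ha : |ax - aS| ≤ D1) :
    |Lv * S' / aS - Lv * x' / ax| ≤ (Dk + Mk * D1 / asj) * th := by
  have hMk : 0 ≤ Mk := (abs_nonneg _).trans hx
  have hD1 : 0 ≤ D1 := (abs_nonneg _).trans ha
  have hth : Lv / aS ≤ th := (div_le_iff₀ haS).mpr hLv
  have hLa : 0 ≤ Lv / aS := div_nonneg hLv0 haS.le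
  have e : Lv * S' / aS - Lv * x' / ax = (Lv / aS) * ((S' - x') + x' * (ax - aS) / ax) := by
    field_simp
    ring
  rw [e, abs_mul, abs_of_nonneg hLa]
  have h1 : |(S' - x') + x' * (ax - aS) / ax| ≤ Dk + Mk * D1 / asj := by
    refine (abs_add_le _ _).trans (add_le_add hS ?_)
    rw [abs_div, abs_mul, abs_of_pos hax]
    calc |x'| * |ax - aS| / ax ≤ Mk * D1 / ax := by gcongr
      _ ≤ Mk * D1 / asj := div_le_div_of_nonneg_left (mul_nonneg hMk hD1) hasj hasx
  have h0 : 0 ≤ Dk + Mk * D1 / asj :=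
    add_nonneg ((abs_nonneg _).trans hS) (div_nonneg (mul_nonneg hMk hD1) hasj.le)
  calc Lv / aS * |(S' - x') + x' * (ax - aS) / ax| ≤ th * (Dk + Mk * D1 / asj) :=
        mul_le_mul hth h1 (abs_nonneg _) (hLa.trans hth)
    _ = (Dk + Mk * D1 / asj) * th := mul_comm _ _

/-- Deviation of the shifted rescaled window state from the certified landing state, top shell:
`|Lv v/aS - Lv v/ax| ≤ E·2^θ·D1/as` when `|v| ≤ E`, `|ax - aS| ≤ D1`, `as ≤ ax`, `Lv ≤ 2^θ aS`.
[folklore] -/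
theorem dev_bound_top {Lv aS ax asj th D1 E v : ℝ} (haS : 0 < aS) (hax : 0 < ax)
    (hasj : 0 < asj) (hasx : asj ≤ ax) (hLv0 : 0 ≤ Lv) (hLv : Lv ≤ th * aS)
    (hv : |v| ≤ E) (ha : |ax - aS| ≤ D1) :
    |Lv * v / aS - Lv * v / ax| ≤ E * th * D1 / asj := by
  have hE : 0 ≤ E := (abs_nonneg _).trans hv
  have hD1 : 0 ≤ D1 := (abs_nonneg _).trans ha
  have hth : Lv / aS ≤ th := (div_le_iff₀ haS).mpr hLv
  have hLa : 0 ≤ Lv / aS := div_nonneg hLv0 haS.le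
  have e : Lv * v / aS - Lv * v / ax = (Lv / aS) * (v * (ax - aS) / ax) := by
    field_simp
  rw [e, abs_mul, abs_of_nonneg hLa, abs_div, abs_mul, abs_of_pos hax]
  have h1 : |v| * |ax - aS| / ax ≤ E * D1 / asj :=
    calc |v| * |ax - aS| / ax ≤ E * D1 / ax := by gcongr
      _ ≤ E * D1 / asj := div_le_div_of_nonneg_left (mul_nonneg hE hD1) hasj hasx
  calc Lv / aS * (|v| * |ax - aS| / ax) ≤ th * (E * D1 / asj) :=
        mul_le_mul hth h1 (by positivity) (hLa.trans hth)
    _ = E * th * D1 / asj := by ring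

end ShadowingTransfer

open ShadowingTransfer in
/-- **Item stmt-NavierStokesRegularity-22924 (`TrappingWindowRungThree.ShadowingTransfer`).**
The exact-flow certificate K1a implies the inclusion trapping certificate K1 (`WindowCertificate`)
with the same frames and boxes, by weighted shadowing in the certified `κ`-tube plus the first-exit
bootstrap (see the module docstring).  MODEL lattice statement; nothing about Navier–Stokes is
concluded. [cite: Tao2016AveragedNS, §5–§6 (the cascade ODE being certified); route
TrappingWindowRungThree, gen-1 split of K1] -/
theorem trappingWindowRungThree_shadowingTransfer_proof :
    Summit.NavierStokesRegularity.NavierStokesRegularity.Theses.TrappingWindowRungThree.ShadowingTransfer := by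
  unfold Summit.NavierStokesRegularity.NavierStokesRegularity.Theses.TrappingWindowRungThree.ShadowingTransfer
    Summit.NavierStokesRegularity.NavierStokesRegularity.Theses.TrappingWindowRungThree.WindowCertificate
  rintro ⟨R, θ, c, η₀, Cb, Cg, τs, mm, Kb, Ka, i₀, α, X₀, M, W, N₀, ℓ, ctr, rad, s, ω, Lv, as, κ, Λ, δ, nx,
    hR, hα, hX₀, hθ0, hθ, hc, hη₀, hη₀1, hCb, hCg, hKb, hKa, hτs, hτsc, hmm, hMW, hPC1, hPC2, hPC3,
    hWC, hdat, hstage, hepoch⟩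
  -- positivity of the shadowing budget `Λ j δ j τs ω j k`
  have hDnn : ∀ j, j ≤ N₀ → ∀ k, 0 ≤ Λ j * δ j * τs * ω j k := fun j hj k =>
    mul_nonneg (mul_nonneg (mul_nonneg (hstage j hj).2.2.2.2.1 (hstage j hj).2.2.2.2.2.1) hτs.le)
      ((hstage j hj).2.2.2.2.2.2.1 k).le
  refine ⟨R, θ, c, η₀, Cb, Cg, Kb, Ka, i₀, α, X₀, N₀, ℓ, ctr, rad, M, W, hR, hα, hX₀, hθ0, hθ, hc,
    hη₀, hη₀1, hCb, hCg, hKb, hKa, ?_, ?_, fun k h1 h2 => (hMW k h1 h2).2, hPC1, hPC2, hPC3, hWC,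
    ?_⟩
  · -- the datum lies in `B_0`
    intro l
    have hs0 := (hstage 0 (Nat.zero_le _)).2.2.1 l
    linarith [hdat l]
  · -- every box lies strictly inside the sup bounds
    intro j hj q hq i k h1 h2
    obtain ⟨τq, x, hτq, -, -, hxwin, -⟩ := hepoch j hj q hq
    have h0 := (hxwin i k h1 h2).2 0 ⟨le_rfl, hτq.le⟩
    rw [(hxwin i k h1 h2).1] at h0
    linarith [h0.2, hDnn j hj k]
  -- THE TRAPPING DICHOTOMY
  intro j η σ τ S F hj hη hηη₀ hσ hστ hC1 hS0 hbm hbp hmot hEn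
  obtain ⟨hnx, -, -, hκ, hΛ0, hδ0, hωpos, hgap, hratio, hland, hdist⟩ := hstage j hj
  obtain ⟨τq, x, hτq, hτqs, hax, hxwin, hxland, hxbot, hxtube⟩ := hepoch j hj (fun i k => S i k 0) hS0
  have hLv1 : 1 ≤ Lv (nx j) := (hstage (nx j) hnx).2.1
  have hsnn : ∀ l, 0 ≤ s (nx j) l := (hstage (nx j) hnx).2.2.1
  -- abbreviations
  set D : ℤ → ℝ := fun k => Λ j * δ j * τs * ω j k with hD_def
  have hD : ∀ k, 0 ≤ D k := fun k => hDnn j hj k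
  set Tm : ℝ := min σ τq with hTm_def
  have hTmσ : Tm ≤ σ := min_le_left _ _
  have hTmq : Tm ≤ τq := min_le_right _ _
  have hTmτs : Tm ≤ τs := hTmq.trans hτqs
  have hTmτ : Tm ≤ τ := hTmσ.trans hστ
  -- derivatives of the window trajectory
  have hSder : ∀ i k, -Kb ≤ k → k ≤ Ka → ∀ t ∈ Icc (0 : ℝ) τ,
      HasDerivWithinAt (S i k) (derivWithin (S i k) (Icc 0 τ) t) (Icc 0 τ) t := by
    intro i k h1 h2 t ht
    exact ((hC1 i k (by omega) (by omega)).differentiableOn one_ne_zero t ht).hasDerivWithinAt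
  -- the defect of the window part against the truncated field (clause DIST)
  have hdef : ∀ t ∈ Ico (0 : ℝ) Tm, (∀ i k, -Kb ≤ k → k ≤ Ka → |S i k t| ≤ M k) →
      ∀ i k, -Kb ≤ k → k ≤ Ka →
        |derivWithin (S i k) (Icc 0 τ) t -
            quadTerm 1 α (fun j' n s' => if -Kb ≤ n ∧ n ≤ Ka then S j' n s' else 0) i k t|
          ≤ δ j * ω j k := by
    intro t ht hM i k h1 h2
    have htσ : t ∈ Icc (0 : ℝ) σ := ⟨ht.1, (ht.2.trans_le hTmσ).le⟩
    have hm := hmot i k h1 h2 t htσ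
    have hd := hdist (fun i' k' => S i' k' t) hM (fun i' => hbm i' t htσ) (fun i' => hbp i' t htσ)
      i k h1 h2
    have e1 : quadTerm 1 α S i k t = quadTerm 1 α (fun j' n (_ : ℝ) => S j' n t) i k 0 :=
      quadTerm_slice 1 α S i k t
    have e2 : quadTerm 1 α (fun j' n s' => if -Kb ≤ n ∧ n ≤ Ka then S j' n s' else 0) i k t =
        quadTerm 1 α (fun j' n (_ : ℝ) => if -Kb ≤ n ∧ n ≤ Ka then S j' n t else 0) i k 0 :=
      quadTerm_slice 1 α _ i k t
    -- the defect allowance: η 2^{2k} √F ≤ η₀ 2^{2k} √(M²/2 + η₀ W)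
    have h2k : 0 < (2 : ℝ) ^ ((2 : ℝ) * (k : ℝ)) := Real.rpow_pos_of_pos two_pos _
    have hW := (hMW k h1 h2).2
    have hSM := hM i k h1 h2
    have hsq : S i k t ^ 2 ≤ M k ^ 2 := by
      rw [← sq_abs (S i k t)]
      exact pow_le_pow_left₀ (abs_nonneg _) hSM 2
    have hF : F i k t ≤ (1 / 2) * M k ^ 2 + η₀ * W k := by
      have := (hEn i k h1 h2 t htσ).2
      nlinarith [mul_le_mul_of_nonneg_right hηη₀ hW]
    have hsqrt : Real.sqrt (F i k t) ≤ Real.sqrt ((1 / 2) * M k ^ 2 + η₀ * W k) :=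
      Real.sqrt_le_sqrt hF
    have hallow : η * (2 : ℝ) ^ ((2 : ℝ) * (k : ℝ)) * Real.sqrt (F i k t) ≤
        η₀ * (2 : ℝ) ^ ((2 : ℝ) * (k : ℝ)) * Real.sqrt ((1 / 2) * M k ^ 2 + η₀ * W k) :=
      mul_le_mul (mul_le_mul_of_nonneg_right hηη₀ h2k.le) hsqrt (Real.sqrt_nonneg _)
        (mul_nonneg hη₀.le h2k.le)
    have esplit : derivWithin (S i k) (Icc 0 τ) t -
        quadTerm 1 α (fun j' n s' => if -Kb ≤ n ∧ n ≤ Ka then S j' n s' else 0) i k t =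
        (derivWithin (S i k) (Icc 0 τ) t - quadTerm 1 α S i k t) +
          (quadTerm 1 α (fun j' n (_ : ℝ) => S j' n t) i k 0 -
            quadTerm 1 α (fun j' n (_ : ℝ) => if -Kb ≤ n ∧ n ≤ Ka then S j' n t else 0) i k 0) := by
      rw [e1, e2]
      ring
    rw [esplit]
    refine (abs_add_le _ _).trans ?_
    linarith [hm, hd, hallow]
  -- WEIGHTED SHADOWING on `[0, min σ τq]`
  have hshadow := window_shadowing (S' := fun i k t => derivWithin (S i k) (Icc 0 τ) t)
    hωpos hΛ0 hδ0 hτs hgap hmm hTmτs hTmq hTmτ (fun i k h1 h2 t ht => (hxwin i k h1 h2).2 t ht)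
    hSder hdef (fun i k h1 h2 => ((hxwin i k h1 h2).1).symm) hxtube
  have hdev : ∀ t ∈ Icc (0 : ℝ) Tm, ∀ i k, -Kb ≤ k → k ≤ Ka → |S i k t - x i k t| ≤ D k := by
    intro t ht i k h1 h2
    refine (hshadow t ht i k h1 h2).trans ?_
    simp only [hD_def]
    have : Λ j * δ j * t ≤ Λ j * δ j * τs :=
      mul_le_mul_of_nonneg_left (ht.2.trans hTmτs) (mul_nonneg hΛ0 hδ0)
    exact mul_le_mul_of_nonneg_right this (hωpos k).le
  have hSM : ∀ t ∈ Icc (0 : ℝ) Tm, ∀ i k, -Kb ≤ k → k ≤ Ka → |S i k t| ≤ M k - mm := by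
    intro t ht i k h1 h2
    have h1' := hdev t ht i k h1 h2
    have h2' := ((hxwin i k h1 h2).2 t ⟨ht.1, ht.2.trans hTmq⟩).2
    have h3' := abs_sub_abs_le_abs_sub (S i k t) (x i k t)
    simp only [hD_def] at h1'
    linarith
  -- CASE SPLIT: does the exact step time fall inside the horizon?
  rcases le_or_gt τq σ with hle | hlt
  · -- STEP at `τ₁ = τq`
    left
    have hTm : Tm = τq := min_eq_right hle
    have hτqI : τq ∈ Icc (0 : ℝ) Tm := ⟨hτq.le, hTm.ge⟩
    have h1w : -Kb ≤ (1 : ℤ) ∧ (1 : ℤ) ≤ Ka := ⟨by linarith, hKa⟩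
    -- the two arrival amplitudes
    set ax : ℝ := |x i₀ 1 τq| with hax_def
    set aS : ℝ := |S i₀ 1 τq| with haS_def
    have haxS : |ax - aS| ≤ D 1 := by
      rw [abs_sub_comm]
      exact (abs_abs_sub_abs_le_abs_sub _ _).trans (hdev τq hτqI i₀ 1 h1w.1 h1w.2)
    have h2θ : 0 < (2 : ℝ) ^ (-θ) := Real.rpow_pos_of_pos two_pos _
    have h2θ' : 0 < (2 : ℝ) ^ θ := Real.rpow_pos_of_pos two_pos _
    have h22 : (2 : ℝ) ^ θ * (2 : ℝ) ^ (-θ) = 1 := by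
      rw [← Real.rpow_add two_pos, add_neg_cancel, Real.rpow_zero]
    have hLv0 : 0 < Lv (nx j) := one_pos.trans_le hLv1
    have hasj : 0 < as j := by
      have : 0 < (2 : ℝ) ^ (-θ) * Lv (nx j) := mul_pos h2θ hLv0
      have hD1 := hD 1
      simp only [hD_def] at hD1
      linarith
    have hax' : as j ≤ ax := hax
    have haxpos : 0 < ax := hasj.trans_le hax'
    have hfloor : (2 : ℝ) ^ (-θ) * Lv (nx j) ≤ aS := by
      have hD1 : D 1 = Λ j * δ j * τs * ω j 1 := rfl
      have := abs_le.mp haxS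
      linarith [this.1, this.2]
    have haSpos : 0 < aS := (mul_pos h2θ hLv0).trans_le hfloor
    have hLvth : Lv (nx j) ≤ (2 : ℝ) ^ θ * aS := by
      have := mul_le_mul_of_nonneg_left hfloor h2θ'.le
      rw [← mul_assoc, h22, one_mul] at this
      exact this
    -- the ratio
    set a : ℝ := aS / Lv (nx j) with ha_def
    have hapos : 0 < a := div_pos haSpos hLv0
    have h2a : (2 : ℝ) ^ (-θ) ≤ a := by
      rw [ha_def, le_div_iff₀ hLv0]
      exact hfloor
    have haS_le : a ≤ aS := div_le_self haSpos.le hLv1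
    have hdiva : ∀ w : ℝ, w / a = Lv (nx j) * w / aS := by
      intro w
      rw [ha_def]
      field_simp
    refine ⟨nx j, τq, a, hnx, hτq, hle, hτqs.trans hτsc, hapos, h2a, haS_le, ?_, ?_, ?_⟩
    · -- landing in the box `B_{nx j}`
      intro l
      set envA : ℝ := Real.sqrt (10 * Cg * (2 : ℝ) ^ (-(7 : ℝ) * ((Ka : ℝ) + 1))) with henvA
      set v : Fin 4 → ℝ := fun i => S i (Ka + 1) τq with hv_def
      have hv : ∀ i, |v i| ≤ envA := fun i => hbp i τq ⟨hτq.le, hle⟩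
      set P : Fin 4 → ℤ → ℝ :=
        fun i k => Lv (nx j) * (if k + 1 ≤ Ka then x i (1 + k) τq else v i) / |x i₀ 1 τq|
        with hP_def
      set Q : Fin 4 → ℤ → ℝ := fun i k => S i (1 + k) τq / a with hQ_def
      have hPl := hxland v hv l
      -- the deviation `u = Q - P` obeys the operator-norm margin hypotheses
      have hu1 : ∀ i k, -Kb ≤ k → k + 1 ≤ Ka →
          |(Q - P) i k| ≤ (Λ j * δ j * τs * ω j (1 + k) +
            M (1 + k) * Λ j * δ j * τs * ω j 1 / as j) * (2 : ℝ) ^ θ := by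
        intro i k hk1 hk2
        have hkw : -Kb ≤ 1 + k ∧ 1 + k ≤ Ka := ⟨by linarith, by linarith⟩
        have e : (Q - P) i k = Lv (nx j) * S i (1 + k) τq / aS - Lv (nx j) * x i (1 + k) τq / ax := by
          simp only [Pi.sub_apply, hQ_def, hP_def, if_pos hk2, hdiva, hax_def]
        rw [e]
        have hb := dev_bound_inner (th := (2 : ℝ) ^ θ) haSpos haxpos hasj hax' hLv0.le hLvth
          (hdev τq hτqI i (1 + k) hkw.1 hkw.2)
          (show |x i (1 + k) τq| ≤ M (1 + k) from
            le_trans ((hxwin i (1 + k) hkw.1 hkw.2).2 τq ⟨hτq.le, le_rfl⟩).2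
              (by linarith [hDnn j hj (1 + k)]))
          haxS
        refine hb.trans (le_of_eq ?_)
        simp only [hD_def]
        ring
      have hu2 : ∀ i, |(Q - P) i Ka| ≤
          envA * (2 : ℝ) ^ θ * Λ j * δ j * τs * ω j 1 / as j := by
        intro i
        have hKa' : ¬ (Ka + 1 ≤ Ka) := by linarith
        have e : (Q - P) i Ka = Lv (nx j) * v i / aS - Lv (nx j) * v i / ax := by
          simp only [Pi.sub_apply, hQ_def, hP_def, if_neg hKa', hdiva, hax_def, hv_def, add_comm]
        rw [e]
        have hb := dev_bound_top (th := (2 : ℝ) ^ θ) haSpos haxpos hasj hax' hLv0.le hLvth (hv i)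
          haxS
        refine hb.trans (le_of_eq ?_)
        simp only [hD_def]
        ring
      have hlu := hland (Q - P) hu1 hu2 l
      have eQ : Q = P + (Q - P) := by abel
      have eℓ : ℓ (nx j) l Q - ctr (nx j) l =
          (ℓ (nx j) l P - ctr (nx j) l) + ℓ (nx j) l (Q - P) := by
        rw [eQ, map_add]
        ring_nf
      show |ℓ (nx j) l Q - ctr (nx j) l| ≤ rad (nx j) l
      rw [eℓ]
      refine (abs_add_le _ _).trans ?_
      linarith [hPl, hlu]
    · -- the bottom shell leaves under the behind envelope
      intro i
      have hKbw : -Kb ≤ -Kb ∧ -Kb ≤ Ka := ⟨le_rfl, by linarith⟩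
      have h1' := hdev τq hτqI i (-Kb) hKbw.1 hKbw.2
      have h2' := hxbot i
      have h3' := abs_sub_abs_le_abs_sub (S i (-Kb) τq) (x i (-Kb) τq)
      have henv : 0 ≤ Cb * (2 : ℝ) ^ ((3 : ℝ) / 4 * ((Kb : ℝ) + 1)) :=
        mul_nonneg hCb.le (Real.rpow_nonneg zero_le_two _)
      have hSb : |S i (-Kb) τq| ≤ (2 : ℝ) ^ (-θ) * (Cb * (2 : ℝ) ^ ((3 : ℝ) / 4 * ((Kb : ℝ) + 1))) := by
        simp only [hD_def] at h1'
        linarith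
      rw [div_le_iff₀ hapos]
      refine hSb.trans ?_
      rw [mul_comm]
      exact mul_le_mul_of_nonneg_left h2a henv
    · -- window bounds up to the step time
      intro i k h1 h2 u hu
      have := hSM u ⟨hu.1, hu.2.trans_eq hTm.symm⟩ i k h1 h2
      linarith
  · -- STRICTLY INSIDE: `σ < τq ≤ τs ≤ c`
    right
    have hTm : Tm = σ := min_eq_left hlt.le
    refine ⟨hlt.trans_le (hτqs.trans hτsc), fun i k h1 h2 u hu => ?_⟩
    have := hSM u ⟨hu.1, hu.2.trans_eq hTm.symm⟩ i k h1 h2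
    linarith

end Summit.NavierStokesRegularity.NavierStokesRegularity.Theorems

end
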